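import Summits.CriticalPhenomena.CardyFormulaZ2.Theorems.CardyMagicRigidityNestingRigidityNeckBridgeChain
import Summits.CriticalPhenomena.CardyFormulaZ2.Theorems.CardyMagicRigidityNestingRigidityNeckCoveringA
import HarnessLib

/-!
# Crux `NestingRigidity`, line `pinch-resampling` (v4), stub S11: the `𝔄`-error on `𝕋` as a necklace of distinct open clusters

Crux `Summit.CriticalPhenomena.CardyFormulaZ2.Theses.CardyMagicRigidity.NestingRigidity` (stmt-CriticalPhenomena-4835),
line `pinch-resampling` v4, stub S11 `stub_neckHookupCoarseT : NeckHookupCoarseT`.  Worker W6c, wave 6: the site-`𝕋` twin of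
`zCovering_A_clusters` / `zCovering_A_chain` (`…NeckZ2CoveringAClusters/AChain`, p164864/p165454), obtained by instantiating
the generic bridge structure of `…NeckBridgeStructure/Chain` at `H = tColourGraph η true`, `O = Λ_{2s}(x)` (the step set
`augSteps s x η F` of `…NeckCoveringA` is `NeckBridge.bAugSteps (tColourGraph η true) (tBall x (2 * s)) F` by `rfl`).

* §1 `exists_needed_family`: on `THookStar ∖ THook` a nonempty finite family `F ⊆ vEdges` over which two non-joined open
  crossings `b, b'` are chained, every edge NEEDED (cardinality-minimal family, as in `covering_A`).
* §2 `nodes_of_needed`: the node property of `covering_A` (cluster-form four arms around every separated sub-family) for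
  ANY needed family (adapted from `covering_A`).
* §3 `tCovering_A_chain` (registered anchor): family, crossings, node property, the three-edge exclusion (no open cluster
  of `Λ_{2s}(x)` contains the locales of three distinct edges: `j` locales come with `⌈j/2⌉` pairwise distinct open clusters,
  each containing a blob of `𝕋`-diameter `≥ lam` — the van den Berg–Kesten input of the summation), and the necklace: rank
  `rk`, endpoints `inP/outP`, `b ⟶ inP e_min`, `outP e ⟶ inP e'` (consecutive), `outP e_max ⟶ b'`, `b ≁ outP e`,
  `outP e ≁ outP e'` (`rk e < rk e'`).
-/

noncomputable section

namespace Summit.CriticalPhenomena.CardyFormulaZ2.Cruxes.NestingRigidity.PinchResampling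

open MeasureTheory Set Literature.Probability.Percolation Literature.Probability.LatticeModels

namespace NeckCoarse

variable {ℓ lam s : ℕ} {x o : Site 2} {η : SiteConfig (Site 2)}

/-- The step set of `…NeckCoveringA` is the generic augmentation of `Λ_{2s}(x)` in the open graph. -/
theorem augSteps_eq_bAugSteps (F : Set (Site 2 × Site 2)) :
    augSteps s x η F = NeckBridge.bAugSteps (tColourGraph η true) (tBall x (2 * s)) F := rfl

/-! ## §1 A needed family -/

/-- **A minimal re-connecting family on `𝕋`**: on `THookStar ∖ THook` (`1 ≤ lam`, `lam + 1 ≤ s`) there are open crossings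
`b, b'` of the collar, not joined by an open path of `Λ_{2s}(x)`, and a nonempty finite family `F ⊆ vEdges` over which they
are chained, every edge of which is needed. -/
theorem exists_needed_family (hlam : 1 ≤ lam) (hls : lam + 1 ≤ s) (hS : η ∈ THookStar ℓ lam s x o)
    (hnH : η ∉ THook x x s s) :
    ∃ (b b' : Site 2) (F : Finset (Site 2 × Site 2)),
      IsCrossing triGraph (tColourGraph η true) (tBall x s) (tBall x (2 * s)) b ∧
      IsCrossing triGraph (tColourGraph η true) (tBall x s) (tBall x (2 * s)) b' ∧
      ¬ PathIn (tColourGraph η true) (tBall x (2 * s)) b b' ∧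
      ↑F ⊆ vEdges ℓ lam s x o η ∧ F.Nonempty ∧
      Relation.ReflTransGen (fun a c ↦ (a, c) ∈ augSteps s x η ↑F) b b' ∧
      ∀ e ∈ F, ¬ Relation.ReflTransGen (fun a c ↦ (a, c) ∈ augSteps s x η (↑F \ {e})) b b' := by
  classical
  -- adapted from `covering_A` (`…NeckCoveringA`) and `NeckCoarseZ2.exists_needed_family`
  obtain ⟨b, b', hb, hb', hnR, hchain⟩ := exists_stepChain_of_tHookStar hlam hls hS hnH
  rw [steps_eq_augSteps] at hchain
  have hfin : (vEdges ℓ lam s x o η).Finite :=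
    ((tBall_finite x (2 * s)).prod (tBall_finite x (2 * s))).subset fun e he ↦
      ⟨(mem_tBall_of_mem_vEdges he).1, (mem_tBall_of_mem_vEdges he).2⟩
  set U : Finset (Site 2 × Site 2) := hfin.toFinset with hU
  let chain : Finset (Site 2 × Site 2) → Prop := fun F ↦
    Relation.ReflTransGen (fun a c ↦ (a, c) ∈ augSteps s x η ↑F) b b'
  set 𝒞 := U.powerset.filter chain with h𝒞
  have hU𝒞 : U ∈ 𝒞 := by
    refine Finset.mem_filter.2 ⟨Finset.mem_powerset.2 subset_rfl, ?_⟩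
    simpa [chain, hU] using hchain
  obtain ⟨F, hF𝒞, hFmin⟩ := Finset.exists_min_image 𝒞 Finset.card ⟨U, hU𝒞⟩
  obtain ⟨hFU, hFchain⟩ := Finset.mem_filter.1 hF𝒞
  have hFU' : (↑F : Set (Site 2 × Site 2)) ⊆ vEdges ℓ lam s x o η := fun e he ↦ by
    have := Finset.mem_powerset.1 hFU he
    simpa [hU] using this
  refine ⟨b, b', F, hb, hb', hnR, hFU', ?_, hFchain, fun e he hch ↦ ?_⟩
  · by_contra hemp
    rw [Finset.not_nonempty_iff_eq_empty] at hemp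
    rcases real_or_endpoint_of_augChain (G := (↑F : Set (Site 2 × Site 2)))
      (fun e he ↦ mem_tBall_of_mem_vEdges (hFU' he)) hb.1.1.1 hFchain with h | ⟨e, he, -⟩
    · exact hnR h
    · simp [hemp] at he
  · have hmem : F.erase e ∈ 𝒞 := by
      refine Finset.mem_filter.2 ⟨Finset.mem_powerset.2 ((Finset.erase_subset e F).trans
        (Finset.mem_powerset.1 hFU)), ?_⟩
      simpa [chain, Finset.coe_erase] using hch
    have h1 := hFmin _ hmem
    have h2 : (F.erase e).card < F.card := Finset.card_erase_lt_of_mem he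
    omega

/-! ## §2 The node property of a needed family -/

/-- **Node property of a needed family on `𝕋`** (the four-arm clause of `covering_A`, for any family of virtual edges over
which two crossings are chained and every edge of which is needed). -/
theorem nodes_of_needed (hℓ : 1 ≤ ℓ) {b b' : Site 2}
    (hb : IsCrossing triGraph (tColourGraph η true) (tBall x s) (tBall x (2 * s)) b)
    (hb' : IsCrossing triGraph (tColourGraph η true) (tBall x s) (tBall x (2 * s)) b')
    {F : Finset (Site 2 × Site 2)} (hFU' : ↑F ⊆ vEdges ℓ lam s x o η)
    (hFchain : Relation.ReflTransGen (fun a c ↦ (a, c) ∈ augSteps s x η ↑F) b b')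
    (hneeded : ∀ e ∈ F, ¬ Relation.ReflTransGen (fun a c ↦ (a, c) ∈ augSteps s x η (↑F \ {e})) b b') :
    ∀ 𝒩 ⊆ F, 𝒩.Nonempty → ∀ (w : Site 2) (Δ r R Γ : ℕ),
      w ∈ innerLayer triGraph (tBall x s) (tBall x (2 * s)) →
      (∀ e ∈ 𝒩, triNorm (e.2 - w) ≤ Δ) → (∀ e ∈ F, e ∉ 𝒩 → (Γ : ℤ) ≤ triNorm (e.2 - w)) →
      Δ + 2 * ℓ + 2 ≤ r → r ≤ R → R + 2 * ℓ + 2 ≤ Γ → R + 2 ≤ s →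
      ∃ p₁ q₁ p₂ q₂, triNorm (p₁ - w) = r ∧ triNorm (q₁ - w) = R ∧ triNorm (p₂ - w) = r ∧ triNorm (q₂ - w) = R ∧
        PathIn (tColourGraph η true) (tAnn w r R) p₁ q₁ ∧ PathIn (tColourGraph η true) (tAnn w r R) p₂ q₂ ∧
        ¬ PathIn (tColourGraph η true) (tAnn w r R) p₁ p₂ := by
  classical
  -- adapted from `covering_A` (`…NeckCoveringA`), with single-edge minimality as in `NeckCoarseZ2.nodes_of_needed`
  set K := tBall x s with hK
  set O := tBall x (2 * s) with hO
  set H := tColourGraph η true with hH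
  have hmin : ∀ 𝒩 ⊆ F, 𝒩.Nonempty →
      ¬ Relation.ReflTransGen (fun a c ↦ (a, c) ∈ augSteps s x η ↑(F \ 𝒩)) b b' := by
    intro 𝒩 h𝒩 hne hch
    obtain ⟨e, he⟩ := hne
    refine hneeded e (h𝒩 he) (augChain_mono (fun q hq ↦ ?_) hch)
    have hq' : q ∈ F ∧ q ∉ 𝒩 := by simpa using hq
    exact ⟨hq'.1, fun h ↦ hq'.2 (by rw [mem_singleton_iff.1 h]; exact he)⟩
  intro 𝒩 h𝒩 hne w Δ r R Γ hw hΔ hΓ hr hrR hRΓ hRs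
  set G : Set (Site 2 × Site 2) := ↑(F \ 𝒩) with hG
  have hGF : G ⊆ ↑F := by intro e he; exact (Finset.mem_sdiff.1 (Finset.mem_coe.1 he)).1
  have hGO : ∀ e ∈ G, e.1 ∈ O ∧ e.2 ∈ O := fun e he ↦ mem_tBall_of_mem_vEdges (hFU' (hGF he))
  have hnG : ¬ Relation.ReflTransGen (fun a c ↦ (a, c) ∈ augSteps s x η G) b b' := hmin 𝒩 h𝒩 hne
  have hsymm : ∀ (F' : Set (Site 2 × Site 2)) {a c : Site 2},
      Relation.ReflTransGen (fun a c ↦ (a, c) ∈ augSteps s x η F') a c →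
      Relation.ReflTransGen (fun a c ↦ (a, c) ∈ augSteps s x η F') c a :=
    fun F' _ _ h ↦ NeckBridge.bAugChain_symm h
  have hout : ∀ {c₀ c₁ : Site 2}, Relation.ReflTransGen (fun a c ↦ (a, c) ∈ augSteps s x η ↑F) c₀ c₁ →
      ¬ Relation.ReflTransGen (fun a c ↦ (a, c) ∈ augSteps s x η G) c₀ c₁ →
      ∃ y e, e ∈ 𝒩 ∧ (y = e.1 ∨ y = e.2) ∧ Relation.ReflTransGen (fun a c ↦ (a, c) ∈ augSteps s x η G) c₀ y := by
    intro c₀ c₁ hch hn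
    obtain ⟨y, z, hy, hz, hyz, -⟩ := reflTransGen_exists_step_out
      (P := {t | Relation.ReflTransGen (fun a c ↦ (a, c) ∈ augSteps s x η G) c₀ t}) hch Relation.ReflTransGen.refl hn
    simp only [mem_setOf_eq] at hy hz
    rcases hyz with hreal | hF | hF
    · exact (hz (hy.tail (Or.inl hreal))).elim
    · by_cases hN : (y, z) ∈ 𝒩
      · exact ⟨y, (y, z), hN, Or.inl rfl, hy⟩
      · exact (hz (hy.tail (Or.inr (Or.inl (Finset.mem_coe.2 (Finset.mem_sdiff.2 ⟨Finset.mem_coe.1 hF, hN⟩)))))).elim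
    · by_cases hN : (z, y) ∈ 𝒩
      · exact ⟨y, (z, y), hN, Or.inr rfl, hy⟩
      · exact (hz (hy.tail (Or.inr (Or.inr (Finset.mem_coe.2 (Finset.mem_sdiff.2 ⟨Finset.mem_coe.1 hF, hN⟩)))))).elim
  obtain ⟨y, e₁, he₁, hy₁, hby⟩ := hout hFchain hnG
  obtain ⟨y', e₂, he₂, hy₂, hb'y'⟩ := hout (hsymm _ hFchain) fun h ↦ hnG (hsymm _ h)
  have hnyy' : ¬ PathIn H O y y' := fun hp ↦
    hnG ((hby.trans (augChain_of_pathIn G hp)).trans (hsymm _ hb'y'))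
  have hnear : ∀ {y : Site 2} {e : Site 2 × Site 2}, e ∈ 𝒩 → (y = e.1 ∨ y = e.2) → triNorm (y - w) < r := by
    intro y e he hy
    have hΔe := hΔ e he
    have hev : e ∈ vEdges ℓ lam s x o η := hFU' (h𝒩 he)
    rcases hy with rfl | rfl
    · have h1 := triNorm_sub_le_of_mem_vEdges hℓ (show (e.1, e.2) ∈ vEdges ℓ lam s x o η from hev)
      have h2 := triNorm_sub_le_triNorm_sub_add e.1 e.2 w
      omega
    · omega
  have hfar : ∀ {c₀ y : Site 2}, IsCrossing triGraph H K O c₀ →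
      Relation.ReflTransGen (fun a c ↦ (a, c) ∈ augSteps s x η G) c₀ y →
      ∃ q, PathIn H O y q ∧ (R : ℤ) ≤ triNorm (q - w) := by
    intro c₀ y hc₀ hch
    rcases real_or_endpoint_of_augChain hGO hc₀.1.1.1 hch with hp | ⟨e, he, hp | hp⟩
    · obtain ⟨-, q, hqo, hpq⟩ := hc₀
      refine ⟨q, (PathIn.symm hp).trans (hpq.mono Set.sdiff_subset), ?_⟩
      have h1 := le_triNorm_of_mem_outerLayer hqo
      have h2 := triNorm_le_of_mem_innerLayer hw
      have h3 := triNorm_sub_le_triNorm_sub_add q w x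
      push_cast at h1 hRs ⊢; omega
    · have heF : e ∈ F ∧ e ∉ 𝒩 := by simpa [hG] using he
      have hΓe := hΓ e heF.1 heF.2
      have hev : e ∈ vEdges ℓ lam s x o η := hFU' heF.1
      refine ⟨e.1, PathIn.symm hp, ?_⟩
      have h1 := triNorm_sub_le_of_mem_vEdges hℓ (show (e.1, e.2) ∈ vEdges ℓ lam s x o η from hev)
      have h2 := triNorm_sub_le_triNorm_sub_add e.2 e.1 w
      have h3 : triNorm (e.2 - e.1) = triNorm (e.1 - e.2) := by rw [← triNorm_neg, neg_sub]
      omega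
    · have heF : e ∈ F ∧ e ∉ 𝒩 := by simpa [hG] using he
      have hΓe := hΓ e heF.1 heF.2
      exact ⟨e.2, PathIn.symm hp, by omega⟩
  obtain ⟨q, hyq, hqR⟩ := hfar hb hby
  obtain ⟨q', hy'q', hq'R⟩ := hfar hb' hb'y'
  obtain ⟨p₁, q₁, hp₁, hq₁, hcross₁, hyp₁⟩ := exists_crossing_of_pathIn hrR (hnear he₁ hy₁) hqR hyq
  obtain ⟨p₂, q₂, hp₂, hq₂, hcross₂, hy'p₂⟩ := exists_crossing_of_pathIn hrR (hnear he₂ hy₂) hq'R hy'q'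
  refine ⟨p₁, q₁, p₂, q₂, hp₁, hq₁, hp₂, hq₂, hcross₁.mono inter_subset_right, hcross₂.mono inter_subset_right,
    fun h12 ↦ hnyy' ?_⟩
  exact hyp₁.trans ((h12.mono (tAnn_subset_tBall hw (by omega))).trans (PathIn.symm hy'p₂))

end NeckCoarse

/-! ## §3 The covering lemma for `𝔄` on `𝕋`, chain form -/

/-- **Covering lemma for `𝔄` on `𝕋`, chain form with the cluster clause (registered helper, anchor of this module on the
crux item).**  On `THookStar ∖ THook` (`1 ≤ ℓ`, `1 ≤ lam`, `lam + 1 ≤ s`) there are two open crossings `b, b'` of the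
collar, not joined by an open path of `Λ_{2s}(x)`, and a nonempty finite family `F ⊆ vEdges` of virtual edges with: the node
property of `covering_A_nodes`; the three-edge exclusion (no open cluster of `Λ_{2s}(x)` contains the locales of three
distinct edges); and a rank `rk` injective on `F` with inner/outer endpoints `inP e, outP e` of every edge along which the
open clusters of `Λ_{2s}(x)` form a necklace of pairwise distinct clusters (`b ⟶ inP e_min`, `outP e ⟶ inP e'` for
rank-consecutive `e, e'`, `outP e_max ⟶ b'`; `b ≁ outP e`; `outP e ≁ outP e'` for `rk e < rk e'`).  Each locale `e.2` is
`inP e` or `outP e` and lies in a blob of `𝕋`-diameter `≥ lam`. -/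
theorem tCovering_A_chain : ∀ (ℓ lam s : ℕ) (x o : Site 2) (η : SiteConfig (Site 2)), 1 ≤ ℓ → 1 ≤ lam → lam + 1 ≤ s → η ∈ THookStar ℓ lam s x o → η ∉ THook x x s s → ∃ (b b' : Site 2) (F : Finset (Site 2 × Site 2)), IsCrossing triGraph (tColourGraph η true) (tBall x s) (tBall x (2 * s)) b ∧ IsCrossing triGraph (tColourGraph η true) (tBall x s) (tBall x (2 * s)) b' ∧ ¬ PathIn (tColourGraph η true) (tBall x (2 * s)) b b' ∧ ↑F ⊆ vEdges ℓ lam s x o η ∧ F.Nonempty ∧ (∀ 𝒩 ⊆ F, 𝒩.Nonempty → ∀ (w : Site 2) (Δ r R Γ : ℕ), w ∈ innerLayer triGraph (tBall x s) (tBall x (2 * s)) → (∀ e ∈ 𝒩, triNorm (e.2 - w) ≤ Δ) → (∀ e ∈ F, e ∉ 𝒩 → (Γ : ℤ) ≤ triNorm (e.2 - w)) → Δ + 2 * ℓ + 2 ≤ r → r ≤ R → R + 2 * ℓ + 2 ≤ Γ → R + 2 ≤ s → ∃ p₁ q₁ p₂ q₂ : Site 2, triNorm (p₁ - w) = r ∧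 triNorm (q₁ - w) = R ∧ triNorm (p₂ - w) = r ∧ triNorm (q₂ - w) = R ∧ PathIn (tColourGraph η true) (tAnn w r R) p₁ q₁ ∧ PathIn (tColourGraph η true) (tAnn w r R) p₂ q₂ ∧ ¬ PathIn (tColourGraph η true) (tAnn w r R) p₁ p₂) ∧ (∀ e₁ ∈ F, ∀ e₂ ∈ F, ∀ e₃ ∈ F, e₁ ≠ e₂ → e₂ ≠ e₃ → e₁ ≠ e₃ → ¬ (PathIn (tColourGraph η true) (tBall x (2 * s)) e₁.2 e₂.2 ∧ PathIn (tColourGraph η true) (tBall x (2 * s)) e₂.2 e₃.2)) ∧ ∃ (rk : Site 2 × Site 2 → ℕ) (inP outP : Site 2 × Site 2 → Site 2), Set.InjOn rk ↑F ∧ (∀ e ∈ F, (inP e, outP e) = e ∨ (outP e, inP e) = e) ∧ (∀ e ∈ F, (∀ e' ∈ F, rk e ≤ rk e') → PathIn (tColourGraph η true) (tBall x (2 * s)) b (inP e)) ∧ (∀ e ∈ F, (∀ e' ∈ F, rk e' ≤ rk e) → PathIn (tColourGraph η true) (tBall x (2 * s)) (outP e) b') ∧ (∀ e ∈ F, ∀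 e' ∈ F, rk e < rk e' → (∀ e'' ∈ F, rk e'' ≤ rk e ∨ rk e' ≤ rk e'') → PathIn (tColourGraph η true) (tBall x (2 * s)) (outP e) (inP e')) ∧ (∀ e ∈ F, ¬ PathIn (tColourGraph η true) (tBall x (2 * s)) b (outP e)) ∧ (∀ e ∈ F, ∀ e' ∈ F, rk e < rk e' → ¬ PathIn (tColourGraph η true) (tBall x (2 * s)) (outP e) (outP e')) := by
  intro ℓ lam s x o η hℓ hlam hls hS hnH
  obtain ⟨b, b', F, hb, hb', hnR, hFU', hne, hFchain, hneeded⟩ := NeckCoarse.exists_needed_family hlam hls hS hnH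
  have hO : ∀ e ∈ (↑F : Set (Site 2 × Site 2)), e.1 ∈ tBall x (2 * s) ∧ e.2 ∈ tBall x (2 * s) := fun e he ↦
    mem_tBall_of_mem_vEdges (hFU' he)
  refine ⟨b, b', F, hb, hb', hnR, hFU', hne, NeckCoarse.nodes_of_needed hℓ hb hb' hFU' hFchain hneeded, ?_, ?_⟩
  · intro e₁ he₁ e₂ he₂ e₃ he₃ h₁₂ h₂₃ h₁₃ ⟨hp₁₂, hp₂₃⟩
    exact NeckBridge.not_three_locales_joined hFchain (hneeded e₁ he₁) (hneeded e₂ he₂) (hneeded e₃ he₃) h₁₂ h₂₃ h₁₃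
      hp₁₂ hp₂₃
  · obtain ⟨rk, inP, outP, h⟩ := NeckBridge.exists_rank_of_needed (tBall_finite x (2 * s)) hFchain
      (fun e he ↦ hneeded e he) hO hb.1.1.1
    exact ⟨rk, inP, outP, h⟩

end Summit.CriticalPhenomena.CardyFormulaZ2.Cruxes.NestingRigidity.PinchResampling

end
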